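import Literature.NumberTheory.LFunctions.ProlateEigenvalueOsipovBound
import Literature.NumberTheory.LFunctions.ProlateEndpointBounds
import Mathlib.Analysis.Calculus.MeanValue
import HarnessLib

/-!
# Bonami–Karoui 2014: `|ψ_{n,c}(1)| ≤ 2.35 √(n+1)` for `q < 1` — DISCHARGE of `BonamiKaroui2014_eq_4`

LINE 1 — FRAMING. RH-FREE corpus literature (special functions: prolate spheroidal wave functions
on `[−1, 1]`); bears_on: LADDER-RH W-C/W-P only as the PROVED-IN-PRINT substitute (cell rh-crit ruling
R55/R58; GAP G-cc-25) for the Rokhlin–Xiao endpoint inequality consumed by Connes–Consani 2021 App. F.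
WHAT THIS IS NOT: any claim about RH; nothing here bears on the truth of RH.

Source: A. Bonami, A. Karoui, *Uniform bounds of prolate spheroidal wave functions and eigenvalues
decay*, C. R. Math. Acad. Sci. Paris 352 (2014) 229–234 [bib: `BonamiKaroui2014`; held text
`paper:doi-10-1016-j-crma-2014-01-004`, printed pp. 229–232 read first-hand].

## What is proved (the printed proof, step by step, for the abstract unit-interval datum
`ProlateLiouville.IsUnitPSWF χ q n g g₁` of `ProlateEigenvalueOsipovBound.lean`, then transported)

* **Thm 2.1, first case (`q ≤ 1`)** `IsUnitPSWF.sq_add_sq_div_le_one`: `A² := ψ(0)² + χ⁻¹ψ′(0)² ≤ 1`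
  for `‖ψ‖_{L²[−1,1]} = 1`.  As printed: the auxiliary `z(t) = (1−t²)(1−qt²)ψ² + (1−t²)²χ⁻¹ψ′²` has
  `z′ = −2t(q+1−2qt²)ψ²` (`hasDerivAt_zAux`), so `A² = z(0) = ∫_{−1}^0 z′ = −∫_0^1 z′` and
  `|z′| ≤ 2ψ²` because `max_{s∈[0,1]} s(q+1−2qs²) ≤ 1` for `q ≤ 1` (`mul_one_add_sub_le_one`); adding,
  `2A² ≤ 2∫ψ² = 2` (p. 230–231, eqs. (6)–(7)).
* **Prop 2.1 (the fundamental inequality (9)) on `[0,1)`** `IsUnitPSWF.sqrt_Qf_mul_sq_le`: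
  `√((1−t²)(1−qt²)) ψ(t)² ≤ A²`.  As printed: Liouville normal form `ψ = Q^{−1/4}U(S(t))`,
  `U″ + (χ + θ)U = 0`, `Z = U² + U′²/(χ+θ)` monotone because `θ∘S` is increasing — carried out in the
  variable `t` with the explicit correction `Θ_q` of `ProlateEigenvalueOsipovBound.lean`
  (`hasDerivAt_ZAux`: `Ẑ′ = −√Q(1−t²)Θ′(ψ′+Lψ)²/((1−qt²)(χ+Θ)²) ≤ 0` by `dtheta_nonneg`), and
  `Ẑ(0) = ψ(0)² + ψ′(0)²/(χ + (1+q)/2) ≤ A²`.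
* **Thm 3.1 second display (12)** `IsUnitPSWF.abs_apply_one_le`: `|ψ(1)| ≤ 2.35√(n+1)`.  As printed
  (p. 231–232): the integrated equation (13) `(1−x²)ψ′(x) = χ∫_x^1(1−qt²)ψ` (`flux_eq_integral`) gives
  `|ψ′| ≤ χ(1−qx₀²)M` on `[x₀,1)` and `M(1 − χQ_q(x₀)) ≤ |ψ(x₀)|` for `M = max_{[x₀,1]}|ψ|`
  (`max_mul_le_abs` — the max over `[x₀,1]` replaces the printed "maximum attained at `1`", so Osipov's
  monotonicity result [7] is not needed); with `Q_q(x₀) = a/χ`, `a = 1/5` (intermediate value theorem)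
  and (9): `ψ(1)² ≤ M² ≤ (25/16)·A²·√(5χ)`; `A ≤ 1` (Thm 2.1) and `χ < (π(n+1)/2)²` (Osipov 2013 Thm 8,
  PROVED in `ProlateEigenvalueOsipovBound.lean` as `chi_lt_of_isUnitPSWF`) give
  `ψ(1)² ≤ (25√5π/32)(n+1) < 2.35²(n+1)` (`κ₁√(π/2) = (5/4)5^{1/4}√(π/2) = 2.343 ≤ 2.35`); when
  `χ < 1/5`, `x₀ = 0` gives `|ψ(1)| ≤ 5/4` directly.
* **The discharge** `BonamiKaroui2014_eq_4_holds : BonamiKaroui2014_eq_4` by rescaling the tree's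
  `IsProlateFunction lam n f` to `[−1,1]` (`IsProlateFunction.isUnitPSWF_rescale`,
  `integral_rescale_sq`; `g(1) = λ^{1/2} f(λ)`).

No new facts; axioms standard.  [cite: BonamiKaroui2014, Thm. 2.1 (5), Prop. 2.1 (9), Thm. 3.1 (11)–(12), eqs. (6), (7), (13)]
[cite: Osipov2013, Thm. 8]  Nothing in this file bears on the truth of the Riemann hypothesis.
-/

noncomputable section

open Real Set MeasureTheory Filter Topology intervalIntegral

namespace Literature.NumberTheory.LFunctions

namespace ProlateLiouville

section bonamiKaroui

variable {χ q : ℝ} {n : ℕ} {g g₁ : ℝ → ℝ}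

/-! ### API of the abstract datum -/

/-- `g₁` is differentiable inside, with `(1−t²) g₁′ = −χρ g + 2t g₁` (the equation solved for `ψ″`).
[cite: BonamiKaroui2014, §1 eq. (1)] -/
theorem IsUnitPSWF.hasDerivAt_g₁ (h : IsUnitPSWF χ q n g g₁) {t : ℝ} (ht : t ∈ Ioo (-1 : ℝ) 1) :
    HasDerivAt g₁ ((-(χ * rho q t) * g t + 2 * t * g₁ t) / (1 - t ^ 2)) t := by
  have hp := one_sub_sq_pos ht
  have hpd : HasDerivAt (fun y : ℝ ↦ 1 - y ^ 2) (-(2 * t)) t := by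
    simpa using (hasDerivAt_pow 2 t).const_sub 1
  have hF := (h.flux t ht).div hpd hp.ne'
  have hev : (fun y ↦ (1 - y ^ 2) * g₁ y / (1 - y ^ 2)) =ᶠ[𝓝 t] g₁ := by
    filter_upwards [isOpen_Ioo.mem_nhds ht] with y hy
    rw [mul_div_cancel_left₀ _ (one_sub_sq_pos hy).ne']
  refine (hF.congr_of_eventuallyEq hev.symm).congr_deriv ?_
  field_simp
  ring

/-- `g` is continuous on `(−1,1)`. [cite: BonamiKaroui2014, §1] -/
theorem IsUnitPSWF.continuousOn_Ioo (h : IsUnitPSWF χ q n g g₁) : ContinuousOn g (Ioo (-1 : ℝ) 1) :=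
  h.cont.mono Ioo_subset_Icc_self

/-! ### Theorem 2.1: `A² = ψ(0)² + ψ′(0)²/χ ≤ 1` for `q ≤ 1` -/

/-- The auxiliary function of Bonami–Karoui's proof of Thm 2.1:
`z(t) = (1−t²)(1−qt²)ψ² + (1−t²)²χ⁻¹ψ′²`, with `z′ = Q′ψ² = −2t(1+q−2qt²)ψ²`.
[cite: BonamiKaroui2014, proof of Thm. 2.1, eq. (6)–(7) p. 230–231] -/
theorem IsUnitPSWF.hasDerivAt_zAux (h : IsUnitPSWF χ q n g g₁) {t : ℝ} (ht : t ∈ Ioo (-1 : ℝ) 1) :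
    HasDerivAt (fun y ↦ Qf q y * g y ^ 2 + ((1 - y ^ 2) * g₁ y) ^ 2 / χ) (dQ q t * g t ^ 2) t := by
  have hχ := h.chi_pos
  have h1 := (hasDerivAt_Qf q t).mul ((h.hasDeriv t ht).pow 2)
  have h2 := ((h.flux t ht).pow 2).div_const χ
  refine ((h1.add h2).congr_of_eventuallyEq (Eventually.of_forall fun y ↦ rfl)).congr_deriv ?_
  simp only [Pi.pow_apply, Nat.cast_ofNat]
  unfold Qf dQ rho
  field_simp
  ring

/-- `t(1+q−2qt²) ≤ 1` for `t, q ∈ [0,1]` (`4(1 − 2t + 2t³) = (2t−1)²(2t+2) + 2(1−t)`), i.e. the bound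
`max_{s∈[0,1]} s(q+1−2qs²) ≤ 1` of (7) for `q ≤ 1`. [cite: BonamiKaroui2014, eq. (7) p. 231] -/
theorem mul_one_add_sub_le_one {t : ℝ} (ht0 : 0 ≤ t) (ht1 : t ≤ 1) (hq : 0 ≤ q) (hq1 : q ≤ 1) :
    t * (1 + q - 2 * q * t ^ 2) ≤ 1 := by
  rcases le_or_gt (1 : ℝ) (2 * t ^ 2) with h2 | h2
  · -- `2t² ≥ 1`: `t(1+q−2qt²) ≤ t ≤ 1`
    nlinarith [mul_nonneg hq (sub_nonneg.2 h2), mul_nonneg ht0 (mul_nonneg hq (sub_nonneg.2 h2))]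
  · -- `2t² < 1`: `q t (1 − 2t²) ≤ t(1−2t²)`, and `1 − 2t + 2t³ ≥ 0`
    have h3 : q * (t * (1 - 2 * t ^ 2)) ≤ 1 * (t * (1 - 2 * t ^ 2)) :=
      mul_le_mul_of_nonneg_right hq1 (mul_nonneg ht0 (by linarith))
    have h4 : 0 ≤ 4 * (1 - 2 * t + 2 * t ^ 3) := by
      nlinarith [mul_nonneg (sq_nonneg (2 * t - 1)) (by linarith : (0:ℝ) ≤ 2 * t + 2)]
    nlinarith

/-- **Bonami–Karoui, Theorem 2.1 (case `q ≤ 1`)**: `ψ(0)² + χ⁻¹ψ′(0)² ≤ 1` for the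
`L²[−1,1]`-normalised solution.  Proof as printed: `A² = z(0) = ∫_{−1}^{0} z′ = −∫_0^1 z′` and
`|z′| = |Q′|ψ² ≤ 2ψ²` on `[−1,1]`, so `2A² ≤ 2∫ψ² = 2`.
[cite: BonamiKaroui2014, Thm. 2.1 eq. (5) (first case) and proof eqs. (6)–(7), p. 230–231] -/
theorem IsUnitPSWF.sq_add_sq_div_le_one (h : IsUnitPSWF χ q n g g₁)
    (hnorm : ∫ t in (-1 : ℝ)..1, g t ^ 2 = 1) :
    g 0 ^ 2 + g₁ 0 ^ 2 / χ ≤ 1 := by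
  have hχ := h.chi_pos
  have hq := h.q_nonneg
  have hq1 := h.q_lt_one.le
  set z : ℝ → ℝ := fun y ↦ Qf q y * g y ^ 2 + ((1 - y ^ 2) * g₁ y) ^ 2 / χ with hz
  have hzc : ContinuousOn z (Icc (-1 : ℝ) 1) := by
    have hQc := (continuous_Qf q).continuousOn (s := Icc (-1 : ℝ) 1)
    exact (hQc.mul (h.cont.pow 2)).add ((((by fun_prop : Continuous fun y : ℝ ↦ 1 - y ^ 2).continuousOn.mul
      h.cont₁).pow 2).div_const χ)
  have hz0 : z 0 = g 0 ^ 2 + g₁ 0 ^ 2 / χ := by simp [hz, Qf]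
  have hz1 : z 1 = 0 := by simp [hz, Qf]
  have hzm1 : z (-1) = 0 := by simp [hz, Qf]
  have hderiv : ∀ t ∈ Ioo (-1 : ℝ) 1, HasDerivAt z (dQ q t * g t ^ 2) t := fun t ht ↦ h.hasDerivAt_zAux ht
  have hdc : ContinuousOn (fun t ↦ dQ q t * g t ^ 2) (Icc (-1 : ℝ) 1) :=
    (by unfold dQ; fun_prop : Continuous (dQ q)).continuousOn.mul (h.cont.pow 2)
  -- FTC on `[0,1]` and `[−1,0]`
  have hI1 : ∫ t in (0 : ℝ)..1, dQ q t * g t ^ 2 = -(g 0 ^ 2 + g₁ 0 ^ 2 / χ) := by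
    rw [intervalIntegral.integral_eq_sub_of_hasDerivAt_of_le zero_le_one
      (hzc.mono (Icc_subset_Icc (by norm_num) le_rfl))
      (fun t ht ↦ hderiv t ⟨by linarith [ht.1], ht.2⟩)
      ((hdc.mono (by rw [uIcc_of_le zero_le_one]; exact Icc_subset_Icc (by norm_num) le_rfl)).intervalIntegrable),
      hz1, hz0]
    ring
  have hI2 : ∫ t in (-1 : ℝ)..0, dQ q t * g t ^ 2 = g 0 ^ 2 + g₁ 0 ^ 2 / χ := by
    rw [intervalIntegral.integral_eq_sub_of_hasDerivAt_of_le (by norm_num : (-1 : ℝ) ≤ 0)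
      (hzc.mono (Icc_subset_Icc le_rfl (by norm_num)))
      (fun t ht ↦ hderiv t ⟨ht.1, by linarith [ht.2]⟩)
      ((hdc.mono (by rw [uIcc_of_le (by norm_num : (-1:ℝ) ≤ 0)]; exact Icc_subset_Icc le_rfl (by norm_num))).intervalIntegrable),
      hzm1, hz0]
    ring
  -- the bounds `−Q′ ≤ 2` on `[0,1]`, `Q′ ≤ 2` on `[−1,0]`
  have hg2i : ∀ a b : ℝ, -1 ≤ a → a ≤ b → b ≤ 1 → IntervalIntegrable (fun t ↦ g t ^ 2) volume a b := by
    intro a b ha hab hb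
    exact ((h.cont.pow 2).mono (by rw [uIcc_of_le hab]; exact Icc_subset_Icc ha hb)).intervalIntegrable
  have hdQi : ∀ a b : ℝ, -1 ≤ a → a ≤ b → b ≤ 1 →
      IntervalIntegrable (fun t ↦ dQ q t * g t ^ 2) volume a b := by
    intro a b ha hab hb
    exact (hdc.mono (by rw [uIcc_of_le hab]; exact Icc_subset_Icc ha hb)).intervalIntegrable
  have hB1 : ∫ t in (0 : ℝ)..1, -(dQ q t * g t ^ 2) ≤ ∫ t in (0 : ℝ)..1, 2 * g t ^ 2 := by
    refine intervalIntegral.integral_mono_on zero_le_one (hdQi 0 1 (by norm_num) zero_le_one le_rfl).neg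
      ((hg2i 0 1 (by norm_num) zero_le_one le_rfl).const_mul 2) fun t ht ↦ ?_
    have hb := mul_one_add_sub_le_one ht.1 ht.2 hq hq1
    have e : -(dQ q t * g t ^ 2) = 2 * (t * (1 + q - 2 * q * t ^ 2)) * g t ^ 2 := by unfold dQ; ring
    rw [e]
    nlinarith [sq_nonneg (g t)]
  have hB2 : ∫ t in (-1 : ℝ)..0, dQ q t * g t ^ 2 ≤ ∫ t in (-1 : ℝ)..0, 2 * g t ^ 2 := by
    refine intervalIntegral.integral_mono_on (by norm_num) (hdQi _ _ le_rfl (by norm_num) (by norm_num))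
      ((hg2i _ _ le_rfl (by norm_num) (by norm_num)).const_mul 2) fun t ht ↦ ?_
    have hb := mul_one_add_sub_le_one (t := -t) (by linarith [ht.2]) (by linarith [ht.1]) hq hq1
    have : dQ q t = 2 * ((-t) * (1 + q - 2 * q * (-t) ^ 2)) := by unfold dQ; ring
    rw [this]
    nlinarith [sq_nonneg (g t)]
  have hsum : (∫ t in (-1 : ℝ)..0, 2 * g t ^ 2) + ∫ t in (0 : ℝ)..1, 2 * g t ^ 2 = 2 := by
    rw [intervalIntegral.integral_add_adjacent_intervals
      ((hg2i _ _ le_rfl (by norm_num) (by norm_num)).const_mul 2)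
      ((hg2i 0 1 (by norm_num) zero_le_one le_rfl).const_mul 2),
      intervalIntegral.integral_const_mul, hnorm]
    ring
  rw [intervalIntegral.integral_neg, hI1, neg_neg] at hB1
  rw [hI2] at hB2
  linarith

/-! ### Proposition 2.1: the fundamental inequality `√Q ψ² ≤ A²` on `[0,1)` -/

/-- The monotone quantity of the Liouville normal form, written in the variable `t`:
`Ẑ(t) = √Q·(ψ² + (1−t²)(ψ′ + Lψ)²/((1−qt²)(χ + Θ)))` (`= U² + U_s²/(χ+θ)` for `U = Q^{1/4}ψ`).
Its derivative is `−√Q (1−t²) Θ′ (ψ′+Lψ)²/((1−qt²)(χ+Θ)²) ≤ 0` on `(0,1)`.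
[cite: BonamiKaroui2014, proof of Prop. 2.1 p. 231 («Z_n(s) = |U(s)|² + |U′(s)|²/(χ_n+θ(s)) is increasing»)] -/
theorem IsUnitPSWF.hasDerivAt_ZAux (h : IsUnitPSWF χ q n g g₁) {t : ℝ} (ht : t ∈ Ioo (-1 : ℝ) 1) :
    HasDerivAt (fun y ↦ Real.sqrt (Qf q y) *
        (g y ^ 2 + (1 - y ^ 2) * (g₁ y + Lf q y * g y) ^ 2 / (rho q y * (χ + theta q y))))
      (-(Real.sqrt (Qf q t) * ((1 - t ^ 2) * dtheta q t * (g₁ t + Lf q t * g t) ^ 2 /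
        (rho q t * (χ + theta q t) ^ 2)))) t := by
  have hχ := h.chi_pos
  have hq := h.q_nonneg
  have hq1 := h.q_lt_one
  have hp := one_sub_sq_pos ht
  have hρ := rho_pos hq1.le ht
  have hQ := Qf_pos hq1.le ht
  have hΘ := theta_pos hq hq1 ht
  have hsQ : 0 < Real.sqrt (Qf q t) := Real.sqrt_pos.2 hQ
  have hE : 0 < χ + theta q t := by linarith
  -- `(√Q)′ = √Q · Q′/(2Q)`
  have hsqrt : HasDerivAt (fun y ↦ Real.sqrt (Qf q y)) (Real.sqrt (Qf q t) * (dQ q t / (2 * Qf q t))) t := by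
    refine ((hasDerivAt_Qf q t).sqrt hQ.ne').congr_deriv ?_
    field_simp
    rw [Real.sq_sqrt hQ.le]
  have hpd : HasDerivAt (fun y : ℝ ↦ 1 - y ^ 2) (-(2 * t)) t := by
    simpa using (hasDerivAt_pow 2 t).const_sub 1
  have hg := h.hasDeriv t ht
  have hg₁ := h.hasDerivAt_g₁ ht
  have hL := hasDerivAt_Lf hq1.le ht
  have hΘd := hasDerivAt_theta hq1.le ht
  have hρd := hasDerivAt_rho q t
  have hV : HasDerivAt (fun y ↦ g₁ y + Lf q y * g y) _ t := hg₁.add (hL.mul hg)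
  have hnum : HasDerivAt (fun y ↦ (1 - y ^ 2) * (g₁ y + Lf q y * g y) ^ 2) _ t := hpd.mul (hV.pow 2)
  have hden : HasDerivAt (fun y ↦ rho q y * (χ + theta q y)) _ t := hρd.mul (hΘd.const_add χ)
  have hH : HasDerivAt (fun y ↦ g y ^ 2 + (1 - y ^ 2) * (g₁ y + Lf q y * g y) ^ 2 /
      (rho q y * (χ + theta q y))) _ t := (hg.pow 2).add (hnum.div hden (mul_pos hρ hE).ne')
  have hZ := hsqrt.mul hH
  refine (hZ.congr_of_eventuallyEq (Eventually.of_forall fun y ↦ rfl)).congr_deriv ?_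
  simp only [Nat.cast_ofNat]
  have hρ' : rho q t ≠ 0 := hρ.ne'
  have hE' : χ + theta q t ≠ 0 := hE.ne'
  have edQ : dQ q t = -2 * t * rho q t - 2 * q * t * (1 - t ^ 2) := by unfold dQ rho; ring
  unfold Lf
  rw [edQ, Qf_eq]
  set P : ℝ := 1 - t ^ 2 with hPdef
  set R : ℝ := rho q t with hRdef
  set Θ : ℝ := theta q t with hΘdef
  set Θd : ℝ := dtheta q t with hΘddef
  set sQ : ℝ := Real.sqrt (P * R) with hsQdef
  have hP' : P ≠ 0 := hp.ne'
  have hsub : (2 : ℕ) - 1 = 1 := rfl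
  simp only [hsub, pow_one]
  set Lv : ℝ := (-2 * t * R - 2 * q * t * P) / (4 * (P * R)) with hLv
  have e1 : (-2 * t * R - 2 * q * t * P) / (2 * (P * R)) = 2 * Lv := by
    rw [hLv]; field_simp; ring
  rw [e1]
  have hLv' : Lv * (4 * (P * R)) = -2 * t * R - 2 * q * t * P := by
    rw [hLv]; field_simp
  field_simp
  linear_combination (sQ * (χ + Θ) * (g₁ t + Lv * g t) ^ 2) * hLv'

/-- **Bonami–Karoui, Proposition 2.1 (fundamental inequality), on `[0,1)`**:
`√((1−t²)(1−qt²))·ψ(t)² ≤ ψ(0)² + χ⁻¹ψ′(0)²`.  Proof as printed (Liouville normal form: `Ẑ` is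
non-increasing in `t` since `Θ′ ≥ 0`, and `Ẑ(0) = ψ(0)² + ψ′(0)²/(χ + (1+q)/2)`).
[cite: BonamiKaroui2014, Prop. 2.1 eq. (9) p. 231, proof p. 231] -/
theorem IsUnitPSWF.sqrt_Qf_mul_sq_le (h : IsUnitPSWF χ q n g g₁) {t : ℝ} (ht0 : 0 ≤ t) (ht1 : t < 1) :
    Real.sqrt (Qf q t) * g t ^ 2 ≤ g 0 ^ 2 + g₁ 0 ^ 2 / χ := by
  have hχ := h.chi_pos
  have hq := h.q_nonneg
  have hq1 := h.q_lt_one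
  set Z : ℝ → ℝ := fun y ↦ Real.sqrt (Qf q y) *
    (g y ^ 2 + (1 - y ^ 2) * (g₁ y + Lf q y * g y) ^ 2 / (rho q y * (χ + theta q y))) with hZ
  have htI : t ∈ Ioo (-1 : ℝ) 1 := ⟨by linarith, ht1⟩
  have hIcc : Icc 0 t ⊆ Ioo (-1 : ℝ) 1 := fun x hx ↦ ⟨by linarith [hx.1], lt_of_le_of_lt hx.2 ht1⟩
  -- `Z` is non-increasing on `[0, t]`
  have hanti : AntitoneOn Z (Icc 0 t) := by
    apply antitoneOn_of_deriv_nonpos (convex_Icc 0 t)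
    · exact fun x hx ↦ (h.hasDerivAt_ZAux (hIcc hx)).continuousAt.continuousWithinAt
    · rw [interior_Icc]
      exact fun x hx ↦ (h.hasDerivAt_ZAux (hIcc (Ioo_subset_Icc_self hx))).differentiableAt.differentiableWithinAt
    · rw [interior_Icc]
      intro x hx
      have hxI := hIcc (Ioo_subset_Icc_self hx)
      rw [(h.hasDerivAt_ZAux hxI).deriv, neg_nonpos]
      have h1 := one_sub_sq_pos hxI
      have h2 := rho_pos hq1.le hxI
      have h3 := theta_pos hq hq1 hxI
      have h4 := dtheta_nonneg hq hq1.le hx.1.le hxI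
      have h5 : 0 ≤ Real.sqrt (Qf q x) := Real.sqrt_nonneg _
      have h6 : 0 < χ + theta q x := by linarith
      positivity
  have hZt : Z t ≤ Z 0 := hanti (left_mem_Icc.2 ht0) (right_mem_Icc.2 ht0) ht0
  have hZ0 : Z 0 ≤ g 0 ^ 2 + g₁ 0 ^ 2 / χ := by
    have hL0 : Lf q 0 = 0 := by simp [Lf, dQ]
    have hQ0 : Qf q 0 = 1 := by simp [Qf]
    have hρ0 : rho q 0 = 1 := by simp [rho]
    simp only [hZ, hL0, hQ0, hρ0, theta_zero, Real.sqrt_one, one_mul, zero_mul, add_zero, sub_zero,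
      ne_eq, OfNat.ofNat_ne_zero, not_false_eq_true, zero_pow]
    gcongr _ + ?_
    · exact div_le_div_of_nonneg_left (sq_nonneg _) hχ (by linarith)
  have hlow : Real.sqrt (Qf q t) * g t ^ 2 ≤ Z t := by
    have h1 := one_sub_sq_pos htI
    have h2 := rho_pos hq1.le htI
    have h3 := theta_pos hq hq1 htI
    have h5 : 0 ≤ Real.sqrt (Qf q t) := Real.sqrt_nonneg _
    have : 0 ≤ (1 - t ^ 2) * (g₁ t + Lf q t * g t) ^ 2 / (rho q t * (χ + theta q t)) := by positivity
    simp only [hZ]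
    nlinarith
  linarith

/-! ### Theorem 3.1 (12): the end-point bound -/

/-- The integrated equation: `(1−x²)ψ′(x) = ∫_x^1 χ(1−qt²)ψ(t)dt` for `x ∈ (−1,1)` (the flux vanishes
at `t = 1` because `ψ′` is bounded there). [cite: BonamiKaroui2014, proof of Thm. 3.1, eq. (13) p. 231] -/
theorem IsUnitPSWF.flux_eq_integral (h : IsUnitPSWF χ q n g g₁) {x : ℝ} (hx : x ∈ Ioo (-1 : ℝ) 1) :
    (1 - x ^ 2) * g₁ x = ∫ t in x..1, χ * rho q t * g t := by
  have hFc : ContinuousOn (fun y ↦ (1 - y ^ 2) * g₁ y) (Icc x 1) :=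
    ((by fun_prop : Continuous fun y : ℝ ↦ 1 - y ^ 2).continuousOn.mul
      (h.cont₁.mono (Icc_subset_Icc hx.1.le le_rfl)))
  have hic : ContinuousOn (fun t ↦ -(χ * rho q t) * g t) (Icc x 1) :=
    ((by unfold rho; fun_prop : Continuous fun t ↦ -(χ * rho q t)).continuousOn.mul
      (h.cont.mono (Icc_subset_Icc hx.1.le le_rfl)))
  have hftc := intervalIntegral.integral_eq_sub_of_hasDerivAt_of_le hx.2.le hFc
    (fun t ht ↦ h.flux t ⟨lt_trans hx.1 ht.1, ht.2⟩)
    ((hic.mono (by rw [uIcc_of_le hx.2.le])).intervalIntegrable)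
  simp only [one_pow, sub_self, zero_mul, zero_sub] at hftc
  have : ∫ t in x..1, χ * rho q t * g t = -∫ t in x..1, -(χ * rho q t) * g t := by
    rw [← intervalIntegral.integral_neg]; congr 1; funext t; ring
  rw [this, hftc]; ring

/-- **The end-point passage of Thm 3.1** (max-free form of (13)): for `0 ≤ x₀ < 1` and
`M = max_{[x₀,1]}|ψ|`, `M(1 − χQ(x₀)) ≤ |ψ(x₀)|`.  (Printed: `ψ(1) − ψ(x) ≤ χψ(1)Q_q(x)` using that the
maximum is attained at `1`; here the maximum over `[x₀,1]` replaces `ψ(1)`, so Osipov's monotonicity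
input is not needed.) [cite: BonamiKaroui2014, proof of Thm. 3.1, eq. (13) and the display after it, p. 231–232] -/
theorem IsUnitPSWF.max_mul_le_abs (h : IsUnitPSWF χ q n g g₁) {x₀ : ℝ} (hx0 : 0 ≤ x₀) (hx1 : x₀ < 1) :
    ∃ M : ℝ, (∀ y ∈ Icc x₀ 1, |g y| ≤ M) ∧ M * (1 - χ * Qf q x₀) ≤ |g x₀| := by
  have hχ := h.chi_pos
  have hq := h.q_nonneg
  have hq1 := h.q_lt_one
  -- the maximum of `|g|` on `[x₀, 1]`
  have hK : IsCompact (Icc x₀ 1) := isCompact_Icc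
  have hne : (Icc x₀ 1).Nonempty := ⟨x₀, left_mem_Icc.2 hx1.le⟩
  have hgc : ContinuousOn (fun y ↦ |g y|) (Icc x₀ 1) :=
    (h.cont.mono (Icc_subset_Icc (by linarith) le_rfl)).abs
  obtain ⟨x₁, hx₁, hmax⟩ := hK.exists_isMaxOn hne hgc
  set M : ℝ := |g x₁| with hM
  have hMb : ∀ y ∈ Icc x₀ 1, |g y| ≤ M := fun y hy ↦ hmax hy
  have hM0 : 0 ≤ M := abs_nonneg _
  refine ⟨M, hMb, ?_⟩
  -- derivative bound on `[x₀, 1)`: `|ψ′(x)| ≤ χ ρ(x₀) M`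
  have hρ0 := rho_pos hq1.le ⟨by linarith, hx1⟩
  set C : ℝ := χ * rho q x₀ * M with hC
  have hbound : ∀ x ∈ Ico x₀ 1, |g₁ x| ≤ C := by
    intro x hx
    have hxI : x ∈ Ioo (-1 : ℝ) 1 := ⟨by linarith [hx.1], hx.2⟩
    have hp := one_sub_sq_pos hxI
    have hflux := h.flux_eq_integral hxI
    -- `|∫_x^1 χρψ| ≤ ∫_x^1 χρ(x₀)M = χρ(x₀)M(1−x)`
    have hint : |∫ t in x..1, χ * rho q t * g t| ≤ C * (1 - x) := by
      have hci : ContinuousOn (fun t ↦ χ * rho q t * g t) (Icc x 1) :=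
        ((by unfold rho; fun_prop : Continuous fun t ↦ χ * rho q t).continuousOn.mul
          (h.cont.mono (Icc_subset_Icc hxI.1.le le_rfl)))
      have h1 : |∫ t in x..1, χ * rho q t * g t| ≤ ∫ t in x..1, |χ * rho q t * g t| :=
        intervalIntegral.abs_integral_le_integral_abs hx.2.le
      have h2 : ∫ t in x..1, |χ * rho q t * g t| ≤ ∫ t in x..1, C := by
        refine intervalIntegral.integral_mono_on hx.2.le
          ((hci.abs).mono (by rw [uIcc_of_le hx.2.le])).intervalIntegrable
          intervalIntegrable_const fun t ht ↦ ?_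
        have ht0 : 0 ≤ t := by linarith [ht.1, hx.1]
        have ht2 : t ^ 2 ≤ 1 := by nlinarith [ht.2]
        have hρt : 0 ≤ rho q t := by unfold rho; nlinarith
        have hρle : rho q t ≤ rho q x₀ := by
          unfold rho
          nlinarith [mul_le_mul_of_nonneg_left (pow_le_pow_left₀ hx0 (hx.1.trans ht.1) 2) hq]
        rw [abs_mul, abs_mul, abs_of_pos hχ, abs_of_nonneg hρt, hC]
        have hgt : |g t| ≤ M := hMb t ⟨by linarith [ht.1, hx.1], ht.2⟩
        gcongr
      have h3 : ∫ _ in x..1, C = C * (1 - x) := by simp [mul_comm]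
      linarith
    have : |g₁ x| = |∫ t in x..1, χ * rho q t * g t| / (1 - x ^ 2) := by
      rw [← hflux, abs_mul, abs_of_pos hp, mul_div_cancel_left₀ _ hp.ne']
    rw [this, div_le_iff₀ hp]
    have hC0 : 0 ≤ C := by positivity
    have : C * (1 - x) ≤ C * (1 - x ^ 2) :=
      mul_le_mul_of_nonneg_left (by nlinarith [hx.1, hx.2]) hC0
    linarith
  -- mean value inequality on `[x₀, 1]`
  have hmv := norm_image_sub_le_of_norm_deriv_right_le_segment
    (h.cont.mono (Icc_subset_Icc (by linarith) le_rfl))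
    (fun x hx ↦ ((h.hasDeriv x ⟨by linarith [hx.1], hx.2⟩).hasDerivWithinAt)) hbound x₁ hx₁
  rw [Real.norm_eq_abs] at hmv
  -- `M = |g x₁| ≤ |g x₀| + C(x₁ − x₀) ≤ |g x₀| + χ Q(x₀) M`
  have h1 : M ≤ |g x₀| + C * (1 - x₀) := by
    have := abs_sub_abs_le_abs_sub (g x₁) (g x₀)
    have hC0 : 0 ≤ C := by positivity
    nlinarith [hx₁.2]
  have h2 : C * (1 - x₀) ≤ χ * Qf q x₀ * M := by
    rw [hC, Qf_eq]
    have : 1 - x₀ ≤ 1 - x₀ ^ 2 := by nlinarith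
    have := mul_le_mul_of_nonneg_left this (by positivity : 0 ≤ χ * rho q x₀ * M)
    nlinarith
  nlinarith

/-- Numerics: `√5 < 2.2361`. [cite: BonamiKaroui2014, Thm. 3.1 (12) («κ₁√(π/2) ≈ 2.35»)] -/
theorem sqrt_five_lt : Real.sqrt 5 < 2.2361 := by
  rw [Real.sqrt_lt' (by norm_num)]; norm_num

/-- **Bonami–Karoui, Theorem 3.1 second display (12), abstract form**: for the `L²`-normalised
unit-interval prolate datum with `q < 1`, `|ψ(1)| ≤ 2.35 √(n+1)`.  Proof as printed: Prop 2.1 at the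
point `x₀` with `Q(x₀) = a/χ`, `a = 1/5`, the end-point passage (13), `A ≤ 1` (Thm 2.1) and
`χ < (π(n+1)/2)²` (Osipov): `ψ(1)² ≤ (25/16)√(5χ) < (25√5π/32)(n+1) < 2.35²(n+1)`; if `χ < 1/5` the
point `x₀ = 0` gives `|ψ(1)| ≤ 5/4` directly.
[cite: BonamiKaroui2014, Thm. 3.1 eq. (12) p. 231 and proof p. 232; Osipov2013, Thm. 8] -/
theorem IsUnitPSWF.abs_apply_one_le (h : IsUnitPSWF χ q n g g₁) (hnorm : ∫ t in (-1 : ℝ)..1, g t ^ 2 = 1) :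
    |g 1| ≤ 2.35 * Real.sqrt (n + 1) := by
  have hχ := h.chi_pos
  have hq := h.q_nonneg
  have hq1 := h.q_lt_one
  have hA := h.sq_add_sq_div_le_one hnorm
  have hn1 : 1 ≤ Real.sqrt (n + 1) := by
    refine (Real.le_sqrt' one_pos).2 ?_
    have := n.cast_nonneg (α := ℝ); nlinarith
  have hg0 : g 0 ^ 2 ≤ 1 := by
    have : 0 ≤ g₁ 0 ^ 2 / χ := by positivity
    linarith
  rcases lt_or_ge χ (1 / 5) with hsmall | hbig
  · -- `χ < 1/5`: `x₀ = 0`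
    obtain ⟨M, hMb, hM⟩ := h.max_mul_le_abs le_rfl zero_lt_one
    have hQ0 : Qf q 0 = 1 := by simp [Qf]
    rw [hQ0, mul_one] at hM
    have hg0' : |g 0| ≤ 1 := by
      have h2 : |g 0| ^ 2 ≤ 1 := by rwa [sq_abs]
      nlinarith [abs_nonneg (g 0)]
    have hM1 : M ≤ 5 / 4 := by nlinarith
    have := hMb 1 (right_mem_Icc.2 zero_le_one)
    nlinarith
  · -- `χ ≥ 1/5`: `Q(x₀) = 1/(5χ)`
    have htarget : 1 / (5 * χ) ∈ Icc (Qf q 1) (Qf q 0) := by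
      have : Qf q 1 = 0 := by simp [Qf]
      have h0 : Qf q 0 = 1 := by simp [Qf]
      rw [this, h0]
      exact ⟨by positivity, by rw [div_le_one (by positivity)]; linarith⟩
    obtain ⟨x₀, hx₀, hQx₀⟩ := intermediate_value_Icc' zero_le_one (continuous_Qf q).continuousOn htarget
    have hx₀1 : x₀ < 1 := by
      rcases eq_or_lt_of_le hx₀.2 with h' | h'
      · exfalso
        rw [h'] at hQx₀
        simp [Qf] at hQx₀
        linarith [hQx₀, (by positivity : (0:ℝ) < 1 / (5 * χ))]
      · exact h'
    obtain ⟨M, hMb, hM⟩ := h.max_mul_le_abs hx₀.1 hx₀1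
    rw [hQx₀] at hM
    have hM' : M * (4 / 5) ≤ |g x₀| := by
      have : 1 - χ * (1 / (5 * χ)) = 4 / 5 := by field_simp; ring
      rwa [this] at hM
    -- Prop 2.1 at `x₀`: `√Q(x₀) g(x₀)² ≤ 1`, `√Q(x₀) = 1/√(5χ)`
    have hP := h.sqrt_Qf_mul_sq_le hx₀.1 hx₀1
    rw [hQx₀] at hP
    have hs5 : 0 < Real.sqrt (5 * χ) := Real.sqrt_pos.2 (by positivity)
    have hsQ : Real.sqrt (1 / (5 * χ)) = 1 / Real.sqrt (5 * χ) := by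
      rw [Real.sqrt_div' _ (by positivity), Real.sqrt_one]
    rw [hsQ] at hP
    have hgx : g x₀ ^ 2 ≤ Real.sqrt (5 * χ) := by
      have := mul_le_mul_of_nonneg_left (hP.trans hA) hs5.le
      rwa [← mul_assoc, mul_one_div_cancel hs5.ne', one_mul, mul_one] at this
    -- Osipov: `χ < (π(n+1)/2)²`, so `√(5χ) < √5·π(n+1)/2`
    have hO := chi_lt_of_isUnitPSWF h
    have hsχ : Real.sqrt χ < π * (n + 1) / 2 := by
      rw [← Real.sqrt_sq (by positivity : (0:ℝ) ≤ π * (n + 1) / 2)]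
      exact Real.sqrt_lt_sqrt hχ.le hO
    have hs5χ : Real.sqrt (5 * χ) = Real.sqrt 5 * Real.sqrt χ := Real.sqrt_mul (by norm_num) χ
    have hM0 : 0 ≤ M := le_trans (abs_nonneg _) (hMb 1 (right_mem_Icc.2 hx₀.2))
    -- `M² ≤ (25/16) g(x₀)² ≤ (25/16) √5 √χ < (25/16) √5 π (n+1)/2 ≤ 2.35² (n+1)`
    have hM2 : M ^ 2 ≤ (25 / 16) * (Real.sqrt 5 * Real.sqrt χ) := by
      rw [← hs5χ]
      have h1 : (M * (4 / 5)) ^ 2 ≤ |g x₀| ^ 2 := pow_le_pow_left₀ (by positivity) hM' 2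
      rw [sq_abs] at h1
      nlinarith
    have hfin : M ^ 2 ≤ (2.35 * Real.sqrt (n + 1)) ^ 2 := by
      rw [mul_pow, Real.sq_sqrt (by positivity)]
      have hπ := Real.pi_lt_d2
      have h5 := sqrt_five_lt
      have hsn : 0 ≤ Real.sqrt χ := Real.sqrt_nonneg _
      have hn0 : (0:ℝ) ≤ n := n.cast_nonneg
      nlinarith [mul_le_mul_of_nonneg_left hsχ.le (Real.sqrt_nonneg 5),
        mul_nonneg (Real.sqrt_nonneg 5) hsn, Real.sqrt_nonneg 5]
    have h1 := hMb 1 (right_mem_Icc.2 hx₀.2)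
    have hr : 0 ≤ 2.35 * Real.sqrt (n + 1) := by positivity
    calc |g 1| ≤ M := h1
      _ ≤ 2.35 * Real.sqrt (n + 1) := by
          by_contra hc
          push Not at hc
          nlinarith [mul_lt_mul'' hc hc hr hr]

end bonamiKaroui

end ProlateLiouville

/-! ### The discharge -/

/-- **DISCHARGE of the named fact `BonamiKaroui2014_eq_4`** (Bonami–Karoui 2014, eq. (4) = Thm. 3.1
(12)): for the tree's prolate function `h_{n,λ}` with eigenvalue `χ > c² = (2πλ²)²`,
`λ^{1/2}|f(λ)| ≤ 2.35 √(n+1)`.  Rescale to `[−1,1]` (`IsProlateFunction.isUnitPSWF_rescale`) and apply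
`IsUnitPSWF.abs_apply_one_le`. [cite: BonamiKaroui2014, §1 eq. (4) p. 230; Thm. 3.1 eq. (12) p. 231] -/
theorem BonamiKaroui2014_eq_4_holds : BonamiKaroui2014_eq_4 := by
  intro lam n f hf χ hχ hq
  have hU := hf.isUnitPSWF_rescale hχ hq
  have h := hU.abs_apply_one_le hf.integral_rescale_sq
  have hlam := hf.lam_pos
  simpa [ProlateLiouville.rescale, abs_mul, abs_of_pos (Real.sqrt_pos.2 hlam)] using h


end Literature.NumberTheory.LFunctions

end
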